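import Literature.Probability.RandomPlanarGeometry.ObservableClockPassage
import HarnessLib

/-!
# The hypothesis `hD` of the real passage theorem from a capacity clock and a real martingale

Topic `Literature/Probability/RandomPlanarGeometry` (families `crit-ising`, `crit-perc`); theorems only, no
definition and no named fact.  Real-valued companion of `ObservableClockPassage.lean`
(`Loewner.exists_discreteMartingaleData_of_clock_of`: complex Doob martingales `c · E[X | 𝒢_n]`), in the shape
consumed by the REAL passage theorem
`Loewner.integral_cylinder_eq_zero_of_discreteMartingales_of_ae_continuousAt`
(`ObservableDiscretePassageAE.lean`), whose per-scale hypothesis `hD` asks for a real martingale `F`,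
stopping times `σ ≤ τ ≤ M` such that the driving values `V_u`, `u ≤ s`, are `𝒢_σ`-measurable, the stopped
values are a.e. bounded by a constant, and off a bad event they approximate a target `N_u(ω)` at some
`u ∈ [s, s + Δ]`, resp. `[t, t + Δ]`.  For percolation the martingale is the conditional probability of a
FIXED crossing event given the first `n` steps of the exploration (a Doob martingale by the domain Markov
property of i.i.d. percolation; possibly stopped at a further stopping step) — a general bounded real
martingale, which is why the martingale is an INPUT here rather than built from `X` and `c`:

* `Loewner.exists_realMartingaleData_of_clock` — one scale: an adapted clock `θ` starting below `Δ`,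
  reaching `t` by step `M` with increments `≤ Δ` off `bad`, a driving process measurable in the right
  σ-algebras (`hVM`, `hVloc`: locality of the Loewner transform), a real martingale `F` a.e. bounded by `C`
  at every step, `ε`-close to the target `N (θ_n ω) ω` at the steps `n ≤ M` with `θ_n ≤ t + Δ` off `bad`
  ⟹ the hitting steps `σ = ν_s ≤ τ = ν_t ≤ M` are stopping times carrying every per-scale clause of `hD`
  (same hitting-step bookkeeping as the complex version: `le_clock_hittingBtwn`,
  `clock_hittingBtwn_le_add`, `isStoppingTime_clock_hittingBtwn`, `measurable_hittingBtwn_of_local`);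
* `Loewner.exists_realMartingaleData_of_clocks` — along a sequence of scales, with targets
  `N k : ℝ≥0 → Ω' k → ℝ` and null sequences `ε, Δ, η`: literally the hypothesis `hD` of the real passage
  theorem (with the bad events of measure `≤ η_k`).

## References

* F. Camia, C. M. Newman, Probab. Theory Related Fields 139 (2007) 473–519, §5 (the conditional crossing
  probability given the exploration is the crossing probability of the slit domain). [CamiaNewman2007]
* H. Duminil-Copin, S. Smirnov, Clay Math. Proc. 15 (2012), proof of Prop. 6.7 (optional stopping at the
  capacity hitting steps `τ_t`). [DuminilCopinSmirnov2012Clay]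
* O. Kallenberg, *Foundations of Modern Probability* (3rd ed., 2021), Lemma 9.6, Thm. 9.12. [Kallenberg2021]
-/

noncomputable section

open MeasureTheory ProbabilityTheory Filter Topology Set
open scoped NNReal ENNReal

namespace Literature.Probability.RandomPlanarGeometry

namespace Loewner

variable {Ω : Type*} {m : MeasurableSpace Ω}

/-! ### One scale: the data of `hD` from a clock and a bounded real martingale -/

section OneScale

variable {P : Measure Ω}

/-- **The real discrete martingale data at one scale, from an adapted clock and a bounded real
martingale.**  Let `𝒢` be a discrete filtration; `θ` an adapted clock; `V` a driving process whose value
`V_u` is `𝒢_M`-measurable and whose restriction to `{u ≤ θ_n}` is `𝒢_n`-measurable; `F` a real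
process (in the application a `𝒢`-martingale) with `|F_n| ≤ C` a.e. at every step; `bad` an event off which the clock starts below `Δ`,
reaches the level `t` by step `M` with increments `≤ Δ`, and `F_n` is `ε`-close to the target
`N (θ_n ω) ω` at every step `n ≤ M` with `θ_n ≤ t + Δ`.  Then for levels `s < t` the hitting steps
`σ = ν_s ≤ τ = ν_t ≤ M` and `F` satisfy every per-scale clause of the hypothesis `hD` of
`integral_cylinder_eq_zero_of_discreteMartingales_of_ae_continuousAt` (the martingale property of `F`
itself is not used here and is carried separately), with the approximation times
`u = θ_σ ∈ [s, s + Δ]`, `u = θ_τ ∈ [t, t + Δ]`.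
[cite: DuminilCopinSmirnov2012Clay, Prop. 6.7 (proof, p. 29)] [cite: CamiaNewman2007, §5] -/
theorem exists_realMartingaleData_of_clock (𝒢 : Filtration ℕ m) {θ : ℕ → Ω → ℝ≥0}
    (hθ : Adapted 𝒢 θ)
    {V : ℝ≥0 → Ω → ℝ} {M : ℕ} (hVM : ∀ u, Measurable[𝒢 M] (V u))
    (hVloc : ∀ n u, Measurable[𝒢 n] ({ω | u ≤ θ n ω}.indicator (V u)))
    {F : ℕ → Ω → ℝ} {C : ℝ} (hFC : ∀ n, ∀ᵐ ω ∂P, ‖F n ω‖ ≤ C)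
    (N : ℝ≥0 → Ω → ℝ) {s t : ℝ≥0} (hst : s < t) {ε Δ : ℝ≥0} {bad : Set Ω}
    (hθ0 : ∀ ω, ω ∉ bad → θ 0 ω ≤ Δ)
    (hreach : ∀ ω, ω ∉ bad → ∃ n ≤ M, t ≤ θ n ω)
    (hincr : ∀ ω, ω ∉ bad → ∀ n, n < M → θ (n + 1) ω ≤ θ n ω + Δ)
    (happrox : ∀ᵐ ω ∂P, ω ∉ bad → ∀ n, n ≤ M → θ n ω ≤ t + Δ →
      ‖F n ω - N (θ n ω) ω‖ ≤ ε) :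
    ∃ (σ τ : Ω → WithTop ℕ) (hσ : IsStoppingTime 𝒢 σ),
      IsStoppingTime 𝒢 τ ∧ σ ≤ τ ∧ (∀ ω, τ ω ≤ M) ∧
      (∀ u, u ≤ s → Measurable[hσ.measurableSpace] (V u)) ∧
      (∀ᵐ ω ∂P, ‖stoppedValue F σ ω‖ ≤ C) ∧ (∀ᵐ ω ∂P, ‖stoppedValue F τ ω‖ ≤ C) ∧
      ∀ᵐ ω ∂P, ω ∉ bad →
        (∃ u ∈ Icc s (s + Δ), ‖stoppedValue F σ ω - N u ω‖ ≤ ε) ∧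
        (∃ u ∈ Icc t (t + Δ), ‖stoppedValue F τ ω - N u ω‖ ≤ ε) := by
  -- the hitting steps
  set νs : Ω → ℕ := fun ω ↦ hittingBtwn θ (Ici s) 0 M ω with hνs
  set νt : Ω → ℕ := fun ω ↦ hittingBtwn θ (Ici t) 0 M ω with hνt
  have hσ : IsStoppingTime 𝒢 (fun ω ↦ ((νs ω : ℕ) : WithTop ℕ)) :=
    isStoppingTime_clock_hittingBtwn hθ
  have hτ : IsStoppingTime 𝒢 (fun ω ↦ ((νt ω : ℕ) : WithTop ℕ)) :=
    isStoppingTime_clock_hittingBtwn hθ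
  have hle : ∀ ω, νs ω ≤ νt ω := fun ω ↦
    hittingBtwn_anti θ 0 M (Ici_subset_Ici.2 hst.le) ω
  have hνtM : ∀ ω, νt ω ≤ M := fun ω ↦ hittingBtwn_le (u := θ) ω
  have hνsM : ∀ ω, νs ω ≤ M := fun ω ↦ (hle ω).trans (hνtM ω)
  -- the a.e. bound at all steps at once
  have hFbd' : ∀ᵐ ω ∂P, ∀ n, ‖F n ω‖ ≤ C := ae_all_iff.2 hFC
  refine ⟨fun ω ↦ ((νs ω : ℕ) : WithTop ℕ), fun ω ↦ ((νt ω : ℕ) : WithTop ℕ), hσ, hτ,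
    fun ω ↦ by simp only; exact_mod_cast hle ω, fun ω ↦ by simp only; exact_mod_cast hνtM ω,
    fun u hu ↦ measurable_hittingBtwn_of_local hθ hu (hVM u) (fun n ↦ hVloc n u), ?_, ?_, ?_⟩
  · filter_upwards [hFbd'] with ω hω
    exact hω (νs ω)
  · filter_upwards [hFbd'] with ω hω
    exact hω (νt ω)
  · filter_upwards [happrox] with ω hωapp hωbad
    have hreach_t : ∃ n ≤ M, t ≤ θ n ω := hreach ω hωbad
    have hreach_s : ∃ n ≤ M, s ≤ θ n ω := by
      obtain ⟨n, hn, hnt⟩ := hreach_t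
      exact ⟨n, hn, hst.le.trans hnt⟩
    have hincr' := hincr ω hωbad
    have hs1 : s ≤ θ (νs ω) ω := le_clock_hittingBtwn hreach_s
    have hs2 : θ (νs ω) ω ≤ s + Δ := clock_hittingBtwn_le_add (hθ0 ω hωbad) hincr'
    have ht1 : t ≤ θ (νt ω) ω := le_clock_hittingBtwn hreach_t
    have ht2 : θ (νt ω) ω ≤ t + Δ := clock_hittingBtwn_le_add (hθ0 ω hωbad) hincr'
    refine ⟨⟨θ (νs ω) ω, ⟨hs1, hs2⟩, ?_⟩, ⟨θ (νt ω) ω, ⟨ht1, ht2⟩, ?_⟩⟩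
    · exact hωapp hωbad (νs ω) (hνsM ω) (hs2.trans (add_le_add hst.le le_rfl))
    · exact hωapp hωbad (νt ω) (hνtM ω) ht2

end OneScale

/-! ### Along a sequence of scales: the hypothesis `hD` of the real passage theorem -/

section Scales

variable {Ω' : ℕ → Type*} {mΩ' : ∀ k, MeasurableSpace (Ω' k)} {P : ∀ k, Measure (Ω' k)}

/-- **The hypothesis `hD` of the real passage theorem from capacity clocks and bounded real martingales.**
Along scales `k`, with targets `N k : ℝ≥0 → Ω' k → ℝ`, null sequences `ε, Δ, η` and a uniform bound `C`:
per scale a filtration, an adapted clock, a horizon `M`, a real martingale `F` a.e. bounded by `C` at every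
step, and a measurable bad event of measure `≤ η_k` off which the clock starts below `Δ_k`, reaches `t` by
step `M` with increments `≤ Δ_k`, and `F_n` is `ε_k`-close to `N k (θ_n ω) ω` at the steps `n ≤ M` with
`θ_n ≤ t + Δ_k` ⟹ literally the hypothesis `hD` of
`integral_cylinder_eq_zero_of_discreteMartingales_of_ae_continuousAt` for `(s, t)`.
[cite: DuminilCopinSmirnov2012Clay, Prop. 6.7 (proof, p. 29)] [cite: CamiaNewman2007, §5] -/
theorem exists_realMartingaleData_of_clocks {V : ∀ k, ℝ≥0 → Ω' k → ℝ}
    (N : ∀ k, ℝ≥0 → Ω' k → ℝ) {s t : ℝ≥0}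
    (hst : s < t) {C : ℝ} {ε Δ η : ℕ → ℝ≥0} (hε : Tendsto ε atTop (𝓝 0))
    (hΔ : Tendsto Δ atTop (𝓝 0)) (hη : Tendsto η atTop (𝓝 0))
    (h : ∀ k, ∃ (𝒢 : Filtration ℕ (mΩ' k)) (θ : ℕ → Ω' k → ℝ≥0) (M : ℕ) (F : ℕ → Ω' k → ℝ)
      (bad : Set (Ω' k)),
      Adapted 𝒢 θ ∧ (∀ ω, ω ∉ bad → θ 0 ω ≤ Δ k) ∧ (∀ u, Measurable[𝒢 M] (V k u)) ∧
      (∀ n u, Measurable[𝒢 n] ({ω | u ≤ θ n ω}.indicator (V k u))) ∧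
      Martingale F 𝒢 (P k) ∧ (∀ n, ∀ᵐ ω ∂P k, ‖F n ω‖ ≤ C) ∧
      MeasurableSet bad ∧ P k bad ≤ η k ∧
      (∀ ω, ω ∉ bad → ∃ n ≤ M, t ≤ θ n ω) ∧
      (∀ ω, ω ∉ bad → ∀ n, n < M → θ (n + 1) ω ≤ θ n ω + Δ k) ∧
      (∀ᵐ ω ∂P k, ω ∉ bad → ∀ n, n ≤ M → θ n ω ≤ t + Δ k →
        ‖F n ω - N k (θ n ω) ω‖ ≤ ε k)) :
    ∃ (ε Δ η : ℕ → ℝ≥0), Tendsto ε atTop (𝓝 0) ∧ Tendsto Δ atTop (𝓝 0) ∧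
      Tendsto η atTop (𝓝 0) ∧
      ∀ k, ∃ (𝒢 : Filtration ℕ (mΩ' k)) (F : ℕ → Ω' k → ℝ) (σ τ : Ω' k → WithTop ℕ)
        (hσ : IsStoppingTime 𝒢 σ) (M : ℕ) (bad : Set (Ω' k)),
        IsStoppingTime 𝒢 τ ∧ Martingale F 𝒢 (P k) ∧ σ ≤ τ ∧ (∀ ω, τ ω ≤ M) ∧
        (∀ u, u ≤ s → Measurable[hσ.measurableSpace] (V k u)) ∧
        (∀ᵐ ω ∂P k, ‖stoppedValue F σ ω‖ ≤ C) ∧ (∀ᵐ ω ∂P k, ‖stoppedValue F τ ω‖ ≤ C) ∧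
        MeasurableSet bad ∧ P k bad ≤ η k ∧
        ∀ᵐ ω ∂P k, ω ∉ bad →
          (∃ u ∈ Icc s (s + Δ k), ‖stoppedValue F σ ω - N k u ω‖ ≤ ε k) ∧
          (∃ u ∈ Icc t (t + Δ k), ‖stoppedValue F τ ω - N k u ω‖ ≤ ε k) := by
  refine ⟨ε, Δ, η, hε, hΔ, hη, fun k ↦ ?_⟩
  obtain ⟨𝒢, θ, M, F, bad, hθ, hθ0, hVM, hVloc, hmart, hFC, hbad, hPbad, hreach, hincr, happrox⟩ :=
    h k
  obtain ⟨σ, τ, hσ, hτ, hστ, hτM, hVσ, hFσ, hFτ, happ⟩ :=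
    exists_realMartingaleData_of_clock 𝒢 hθ hVM hVloc hFC (N k) hst hθ0 hreach hincr happrox
  exact ⟨𝒢, F, σ, τ, hσ, M, bad, hτ, hmart, hστ, hτM, hVσ, hFσ, hFτ, hbad, hPbad, happ⟩

end Scales

end Loewner

end Literature.Probability.RandomPlanarGeometry

end
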